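import Mathlib.Data.Finset.Card
import Mathlib.Data.Set.Function
import Mathlib.Logic.Function.Basic
import Mathlib.Order.UpperLower.Basic
import Mathlib.Data.Fintype.Pi
import Mathlib.Data.Fin.Basic

/-!
# Faces of sub-cubes as `ι → Fin 3`, twisted copies, the copy order, and the robust source/target families
# (infrastructure for THEOREM A — the one-sided robust three-partition matching; lineage `prim-bnk-2`, generation 25)

Support file (`--supports stmt-CriticalPhenomena-4575`; memo `run/shared/lean/prim/prim-l12/FROM-prim-bnk-2-g25-ROBUST-MATCHING.md`).
No `sorry`, standard axioms.  The `def`s are local combinatorial encodings (all `Set`/`Finset`-valued): a FACE of the sub-cube on an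
active coordinate set `s ⊆ ι` is a map `ω : ι → Fin 3` (`ω i = j` ⟺ `i ∈ S_j`, the ordered 3-partition `(S₁,S₂,S₃)` of `s`;
`ω = 0` off `s`) — `faces s`; its COPIES for a twist `τ` are `cp τ s j ω = {i ∈ s : (ω i = j) xor (i ∈ τ)}` (`= S_j ∆ (τ ∩ s)`;
copy `0 = a`, `1 = b`, `2 = c` = the layer); `above τ s ω` is the principal up-set of `ω` in the COPY ORDER (`a ⊆ a′ ∧ b ⊆ b′`);
for up-sets `G, H ⊆ 𝒫(ι)` and a side function `σ : Set ι → Bool` (`false = a`, `true = b`) the robust SOURCE family of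
THEOREM A is `Nfam τ s G H = {c ∈ G, a ∉ H}` (constant source side `a`) and the TARGET family is
`Pfam τ s H Ga Gb σ = {c ∉ H, σ(c)=a → a ∈ Ga, σ(c)=b → b ∈ Gb}` (THEOREM A has `Ga = Gb = G`; its coordinate slices need `Ga ≠ Gb`).
Content: how faces, copies, the order and the two families decompose along one coordinate `e` (`ω ↦ (ω e, update ω e 0)`),
for an untwisted (`e ∉ τ`, local poset `V`) and a twisted (`e ∈ τ`, local poset `Λ`) coordinate — the bookkeeping of the inductive
step of THEOREM A (files `…RobustSections`, `…RobustStepUntwisted`, `…RobustMatching`). [this work]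
-/

namespace Summit.CriticalPhenomena.PercolationContinuityZ3.Theorems.ThreePartition

open Finset Function
open scoped Classical

noncomputable section

variable {ι : Type*} [Fintype ι]

/-! ## Faces, copies, order -/

/-- The faces of the sub-cube on `s`: maps `ι → Fin 3` vanishing off `s`. [this work] -/
def faces (s : Finset ι) : Set (ι → Fin 3) := {ω | ∀ i, i ∉ s → ω i = 0}

omit [Fintype ι] in
/-- Membership in `faces`. [this work] -/
theorem mem_faces {s : Finset ι} {ω : ι → Fin 3} : ω ∈ faces s ↔ ∀ i, i ∉ s → ω i = 0 := Iff.rfl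

/-- The `j`-th twisted copy of a face of the sub-cube `s`: `{i ∈ s : (ω i = j) xor (i ∈ τ)}` (`= S_j ∆ (τ ∩ s)`). [this work] -/
def cp (τ : Set ι) (s : Finset ι) (j : Fin 3) (ω : ι → Fin 3) : Set ι := {i | i ∈ s ∧ (ω i = j ↔ i ∉ τ)}

/-- The principal up-set of a face in the COPY ORDER (`a ⊆ a′` and `b ⊆ b′`). [this work] -/
def above (τ : Set ι) (s : Finset ι) (ω : ι → Fin 3) : Set (ι → Fin 3) :=
  {ω' | cp τ s 0 ω ⊆ cp τ s 0 ω' ∧ cp τ s 1 ω ⊆ cp τ s 1 ω'}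

omit [Fintype ι] in
/-- Membership in `above`: the copy order. [this work] -/
theorem mem_above {τ : Set ι} {s : Finset ι} {ω ω' : ι → Fin 3} :
    ω' ∈ above τ s ω ↔ cp τ s 0 ω ⊆ cp τ s 0 ω' ∧ cp τ s 1 ω ⊆ cp τ s 1 ω' := Iff.rfl

/-- Robust SOURCES with constant side `a`: faces of `s` with layer `c ∈ G` and copy `a ∉ H`. [this work] -/
def Nfam (τ : Set ι) (s : Finset ι) (G H : Set (Set ι)) : Finset (ι → Fin 3) :=
  univ.filter fun ω => ω ∈ faces s ∧ cp τ s 2 ω ∈ G ∧ cp τ s 0 ω ∉ H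

/-- Robust TARGETS for a side function `σ`: faces of `s` with layer `c ∉ H` and `σ(c)`-copy `∈ G`; the two side tests may
differ (`Ga` for side `a`, `Gb` for side `b`) — the coordinate slices of THEOREM A need this generality. [this work] -/
def Pfam (τ : Set ι) (s : Finset ι) (H Ga Gb : Set (Set ι)) (σ : Set ι → Bool) : Finset (ι → Fin 3) :=
  univ.filter fun ω => ω ∈ faces s ∧ cp τ s 2 ω ∉ H ∧
    (if σ (cp τ s 2 ω) then cp τ s 1 ω ∈ Gb else cp τ s 0 ω ∈ Ga)

omit [Fintype ι] in
/-- Membership in a copy. [this work] -/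
@[simp] theorem mem_cp (τ : Set ι) (s : Finset ι) (j : Fin 3) (ω : ι → Fin 3) (i : ι) :
    i ∈ cp τ s j ω ↔ i ∈ s ∧ (ω i = j ↔ i ∉ τ) := Iff.rfl

omit [Fintype ι] in
/-- Copies live inside the active set. [this work] -/
theorem cp_subset (τ : Set ι) (s : Finset ι) (j : Fin 3) (ω : ι → Fin 3) : cp τ s j ω ⊆ ↑s :=
  fun _ hi => hi.1

/-- Membership in the source family. [this work] -/
theorem mem_Nfam {τ : Set ι} {s : Finset ι} {G H : Set (Set ι)} {ω : ι → Fin 3} :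
    ω ∈ Nfam τ s G H ↔ ω ∈ faces s ∧ cp τ s 2 ω ∈ G ∧ cp τ s 0 ω ∉ H := by
  simp [Nfam]

/-- Membership in the target family. [this work] -/
theorem mem_Pfam {τ : Set ι} {s : Finset ι} {H Ga Gb : Set (Set ι)} {σ : Set ι → Bool} {ω : ι → Fin 3} :
    ω ∈ Pfam τ s H Ga Gb σ ↔ ω ∈ faces s ∧ cp τ s 2 ω ∉ H ∧
      (if σ (cp τ s 2 ω) then cp τ s 1 ω ∈ Gb else cp τ s 0 ω ∈ Ga) := by
  simp [Pfam]

omit [Fintype ι] in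
/-- The copy order is reflexive. [this work] -/
theorem mem_above_self (τ : Set ι) (s : Finset ι) (ω : ι → Fin 3) : ω ∈ above τ s ω := ⟨le_rfl, le_rfl⟩

/-! ## Decomposition along a coordinate `e ∉ s'` (`s = insert e s'`) -/

section Decomp

variable (τ : Set ι) {s' : Finset ι} {e : ι}

omit [Fintype ι] in
/-- Restricting a face of `insert e s'` to `s'`. [this work] -/
theorem faces_update_zero (he : e ∉ s') {ω : ι → Fin 3} (hω : ω ∈ faces (insert e s')) : update ω e 0 ∈ faces s' := by
  intro i hi
  by_cases hie : i = e
  · subst hie; rw [update_self]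
  · rw [update_of_ne hie]; exact hω i (by rw [Finset.mem_insert, not_or]; exact ⟨hie, hi⟩)

omit [Fintype ι] in
/-- Extending a face of `s'` by a value at `e`. [this work] -/
theorem faces_update {ω : ι → Fin 3} (hω : ω ∈ faces s') (k : Fin 3) : update ω e k ∈ faces (insert e s') := by
  intro i hi
  rw [Finset.mem_insert, not_or] at hi
  rw [update_of_ne hi.1]; exact hω i hi.2

omit [Fintype ι] in
/-- A face of `s'` vanishes at `e ∉ s'`. [this work] -/
theorem face_apply_eq_zero (he : e ∉ s') {ω : ι → Fin 3} (hω : ω ∈ faces s') : ω e = 0 := hω e he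

omit [Fintype ι] in
/-- Reassembling a face from its value at `e` and its restriction. [this work] -/
theorem update_update_eq_self (ω : ι → Fin 3) : update (update ω e 0) e (ω e) = ω := by
  ext i; by_cases hie : i = e
  · subst hie; rw [update_self]
  · rw [update_of_ne hie, update_of_ne hie]

omit [Fintype ι] in
/-- The restriction of an extension. [this work] -/
theorem update_update_zero (ω : ι → Fin 3) (k : Fin 3) : update (update ω e k) e 0 = update ω e 0 := by
  rw [update_idem]

omit [Fintype ι] in
/-- Reassembling a face from its restriction and a prescribed value at `e`. [this work] -/
theorem update_update_of_apply_eq (ω : ι → Fin 3) {k : Fin 3} (h : ω e = k) : update (update ω e 0) e k = ω := by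
  rw [← h]; exact update_update_eq_self ω

omit [Fintype ι] in
/-- Copies of a face of the smaller cube do not contain the new coordinate. [this work] -/
theorem notMem_cp (he : e ∉ s') (j : Fin 3) (ω : ι → Fin 3) : e ∉ cp τ s' j ω := fun h => he h.1

omit [Fintype ι] in
/-- Copies of the smaller cube ignore the value at `e`. [this work] -/
theorem cp_update (he : e ∉ s') (j k : Fin 3) (ω : ι → Fin 3) : cp τ s' j (update ω e k) = cp τ s' j ω := by
  ext i
  simp only [mem_cp]
  by_cases hie : i = e
  · subst hie; exact ⟨fun h => absurd h.1 he, fun h => absurd h.1 he⟩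
  · rw [update_of_ne hie]

omit [Fintype ι] in
/-- **Copy decomposition.**  The `j`-th copy of the extension of `ω` by the value `k` at `e` is the `j`-th copy of `ω`,
plus `e` exactly when `(k = j) xor (e ∈ τ)`. [this work] -/
theorem cp_insert_update (he : e ∉ s') (j k : Fin 3) (ω : ι → Fin 3) :
    cp τ (insert e s') j (update ω e k) =
      if (k = j ↔ e ∉ τ) then insert e (cp τ s' j ω) else cp τ s' j ω := by
  ext i
  by_cases hie : i = e
  · subst hie
    simp only [mem_cp, Finset.mem_insert, true_or, true_and, update_self]
    split_ifs with h
    · simp only [Set.mem_insert_iff, true_or, iff_true]; exact h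
    · simp only [mem_cp, he, false_and, iff_false]; exact h
  · have : (i ∈ cp τ (insert e s') j (update ω e k)) ↔ i ∈ cp τ s' j ω := by
      simp only [mem_cp, Finset.mem_insert, hie, false_or, update_of_ne hie]
    rw [this]
    split_ifs
    · simp only [Set.mem_insert_iff, hie, false_or]
    · rfl

omit [Fintype ι] in
/-- Copies in the bigger cube of a face, via its restriction. [this work] -/
theorem cp_insert (he : e ∉ s') (j : Fin 3) (ω : ι → Fin 3) :
    cp τ (insert e s') j ω =
      if (ω e = j ↔ e ∉ τ) then insert e (cp τ s' j (update ω e 0)) else cp τ s' j (update ω e 0) := by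
  conv_lhs => rw [← update_update_eq_self (e := e) ω]
  rw [cp_insert_update τ he, cp_update τ he]

omit [Fintype ι] in
/-- Order decomposition (sufficient condition): restrictions comparable and compatible values at `e`. [this work] -/
theorem mem_above_insert_of (he : e ∉ s') {ω ω' : ι → Fin 3} (h : update ω' e 0 ∈ above τ s' (update ω e 0))
    (h0 : (ω e = 0 ↔ e ∉ τ) → (ω' e = 0 ↔ e ∉ τ)) (h1 : (ω e = 1 ↔ e ∉ τ) → (ω' e = 1 ↔ e ∉ τ)) :
    ω' ∈ above τ (insert e s') ω := by
  constructor
  · rw [cp_insert τ he 0 ω, cp_insert τ he 0 ω']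
    split_ifs with ha hb
    · exact Set.insert_subset_insert h.1
    · exact absurd (h0 ha) hb
    · exact h.1.trans (Set.subset_insert _ _)
    · exact h.1
  · rw [cp_insert τ he 1 ω, cp_insert τ he 1 ω']
    split_ifs with ha hb
    · exact Set.insert_subset_insert h.2
    · exact absurd (h1 ha) hb
    · exact h.2.trans (Set.subset_insert _ _)
    · exact h.2

end Decomp

/-! ## Sections of up-sets along a coordinate -/

omit [Fintype ι] in
/-- The section `{u : insert e u ∈ G}` of an up-set is an up-set. [this work] -/
theorem isUpperSet_preimage_insert {G : Set (Set ι)} (hG : IsUpperSet G) (e : ι) :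
    IsUpperSet ((fun u : Set ι => insert e u) ⁻¹' G) :=
  fun _ _ huv hu => hG (Set.insert_subset_insert huv) hu

omit [Fintype ι] in
/-- An up-set is contained in its section. [this work] -/
theorem mem_preimage_insert_of_mem {G : Set (Set ι)} (hG : IsUpperSet G) (e : ι) {u : Set ι} (hu : u ∈ G) :
    u ∈ (fun u : Set ι => insert e u) ⁻¹' G :=
  hG (Set.subset_insert e u) hu


/-! ## Membership of extended faces in the source / target families -/

section MemDecomp

variable (τ : Set ι) {s' : Finset ι} {e : ι} (G H Ga Gb : Set (Set ι)) (σ : Set ι → Bool)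

/-- Faces in a source family are faces. [this work] -/
theorem faces_of_mem_Nfam {s : Finset ι} {ω : ι → Fin 3} (h : ω ∈ Nfam τ s G H) : ω ∈ faces s := (mem_Nfam.1 h).1

/-- Faces in a target family are faces. [this work] -/
theorem faces_of_mem_Pfam {s : Finset ι} {ω : ι → Fin 3} (h : ω ∈ Pfam τ s H Ga Gb σ) : ω ∈ faces s := (mem_Pfam.1 h).1

omit [Fintype ι] in
/-- A face of `s'` is fixed by resetting the value at `e ∉ s'`. [this work] -/
theorem update_eq_self_of_faces (he : e ∉ s') {ω : ι → Fin 3} (hω : ω ∈ faces s') : update ω e 0 = ω := by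
  rw [← face_apply_eq_zero he hω]; exact update_eq_self e ω

/-- Source membership of an extended face, UNTWISTED coordinate, `e` in copy `a`. [this work] -/
theorem mem_Nfam_ext0 (he : e ∉ s') (heτ : e ∉ τ) {ω : ι → Fin 3} (hω : ω ∈ faces s') :
    update ω e 0 ∈ Nfam τ (insert e s') G H ↔ ω ∈ Nfam τ s' G ((fun u : Set ι => insert e u) ⁻¹' H) := by
  rw [mem_Nfam, mem_Nfam, cp_insert_update τ he, cp_insert_update τ he]
  simp [heτ, hω, faces_update hω]

/-- Source membership of an extended face, untwisted coordinate, `e` in copy `b`. [this work] -/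
theorem mem_Nfam_ext1 (he : e ∉ s') (heτ : e ∉ τ) {ω : ι → Fin 3} (hω : ω ∈ faces s') :
    update ω e 1 ∈ Nfam τ (insert e s') G H ↔ ω ∈ Nfam τ s' G H := by
  rw [mem_Nfam, mem_Nfam, cp_insert_update τ he, cp_insert_update τ he]
  simp [heτ, hω, faces_update hω]

/-- Source membership of an extended face, untwisted coordinate, `e` free (in the layer). [this work] -/
theorem mem_Nfam_ext2 (he : e ∉ s') (heτ : e ∉ τ) {ω : ι → Fin 3} (hω : ω ∈ faces s') :
    update ω e 2 ∈ Nfam τ (insert e s') G H ↔ ω ∈ Nfam τ s' ((fun u : Set ι => insert e u) ⁻¹' G) H := by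
  rw [mem_Nfam, mem_Nfam, cp_insert_update τ he, cp_insert_update τ he]
  simp [heτ, hω, faces_update hω]

/-- Target membership of an extended face, untwisted coordinate, `e` in copy `a`. [this work] -/
theorem mem_Pfam_ext0 (he : e ∉ s') (heτ : e ∉ τ) {ω : ι → Fin 3} (hω : ω ∈ faces s') :
    update ω e 0 ∈ Pfam τ (insert e s') H Ga Gb σ ↔
      ω ∈ Pfam τ s' H ((fun u : Set ι => insert e u) ⁻¹' Ga) Gb σ := by
  rw [mem_Pfam, mem_Pfam, cp_insert_update τ he, cp_insert_update τ he, cp_insert_update τ he]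
  simp [heτ, hω, faces_update hω]

/-- Target membership of an extended face, untwisted coordinate, `e` in copy `b`. [this work] -/
theorem mem_Pfam_ext1 (he : e ∉ s') (heτ : e ∉ τ) {ω : ι → Fin 3} (hω : ω ∈ faces s') :
    update ω e 1 ∈ Pfam τ (insert e s') H Ga Gb σ ↔
      ω ∈ Pfam τ s' H Ga ((fun u : Set ι => insert e u) ⁻¹' Gb) σ := by
  rw [mem_Pfam, mem_Pfam, cp_insert_update τ he, cp_insert_update τ he, cp_insert_update τ he]
  simp [heτ, hω, faces_update hω]

/-- Target membership of an extended face, untwisted coordinate, `e` free. [this work] -/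
theorem mem_Pfam_ext2 (he : e ∉ s') (heτ : e ∉ τ) {ω : ι → Fin 3} (hω : ω ∈ faces s') :
    update ω e 2 ∈ Pfam τ (insert e s') H Ga Gb σ ↔
      ω ∈ Pfam τ s' ((fun u : Set ι => insert e u) ⁻¹' H) Ga Gb (fun c => σ (insert e c)) := by
  rw [mem_Pfam, mem_Pfam, cp_insert_update τ he, cp_insert_update τ he, cp_insert_update τ he]
  simp [heτ, hω, faces_update hω]

/-- Source membership of an extended face, TWISTED coordinate, `e` missing from copy `a`. [this work] -/
theorem mem_Nfam_ext0_tw (he : e ∉ s') (heτ : e ∈ τ) {ω : ι → Fin 3} (hω : ω ∈ faces s') :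
    update ω e 0 ∈ Nfam τ (insert e s') G H ↔ ω ∈ Nfam τ s' ((fun u : Set ι => insert e u) ⁻¹' G) H := by
  rw [mem_Nfam, mem_Nfam, cp_insert_update τ he, cp_insert_update τ he]
  simp [heτ, hω, faces_update hω]

/-- Source membership of an extended face, twisted coordinate, `e` missing from copy `b`. [this work] -/
theorem mem_Nfam_ext1_tw (he : e ∉ s') (heτ : e ∈ τ) {ω : ι → Fin 3} (hω : ω ∈ faces s') :
    update ω e 1 ∈ Nfam τ (insert e s') G H ↔
      ω ∈ Nfam τ s' ((fun u : Set ι => insert e u) ⁻¹' G) ((fun u : Set ι => insert e u) ⁻¹' H) := by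
  rw [mem_Nfam, mem_Nfam, cp_insert_update τ he, cp_insert_update τ he]
  simp [heτ, hω, faces_update hω]

/-- Source membership of an extended face, twisted coordinate, `e` missing from the layer. [this work] -/
theorem mem_Nfam_ext2_tw (he : e ∉ s') (heτ : e ∈ τ) {ω : ι → Fin 3} (hω : ω ∈ faces s') :
    update ω e 2 ∈ Nfam τ (insert e s') G H ↔ ω ∈ Nfam τ s' G ((fun u : Set ι => insert e u) ⁻¹' H) := by
  rw [mem_Nfam, mem_Nfam, cp_insert_update τ he, cp_insert_update τ he]
  simp [heτ, hω, faces_update hω]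

/-- Target membership of an extended face, twisted coordinate, `e` missing from copy `a`. [this work] -/
theorem mem_Pfam_ext0_tw (he : e ∉ s') (heτ : e ∈ τ) {ω : ι → Fin 3} (hω : ω ∈ faces s') :
    update ω e 0 ∈ Pfam τ (insert e s') H Ga Gb σ ↔
      ω ∈ Pfam τ s' ((fun u : Set ι => insert e u) ⁻¹' H) Ga ((fun u : Set ι => insert e u) ⁻¹' Gb)
        (fun c => σ (insert e c)) := by
  rw [mem_Pfam, mem_Pfam, cp_insert_update τ he, cp_insert_update τ he, cp_insert_update τ he]
  simp [heτ, hω, faces_update hω]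

/-- Target membership of an extended face, twisted coordinate, `e` missing from copy `b`. [this work] -/
theorem mem_Pfam_ext1_tw (he : e ∉ s') (heτ : e ∈ τ) {ω : ι → Fin 3} (hω : ω ∈ faces s') :
    update ω e 1 ∈ Pfam τ (insert e s') H Ga Gb σ ↔
      ω ∈ Pfam τ s' ((fun u : Set ι => insert e u) ⁻¹' H) ((fun u : Set ι => insert e u) ⁻¹' Ga) Gb
        (fun c => σ (insert e c)) := by
  rw [mem_Pfam, mem_Pfam, cp_insert_update τ he, cp_insert_update τ he, cp_insert_update τ he]
  simp [heτ, hω, faces_update hω]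

/-- Target membership of an extended face, twisted coordinate, `e` missing from the layer. [this work] -/
theorem mem_Pfam_ext2_tw (he : e ∉ s') (heτ : e ∈ τ) {ω : ι → Fin 3} (hω : ω ∈ faces s') :
    update ω e 2 ∈ Pfam τ (insert e s') H Ga Gb σ ↔
      ω ∈ Pfam τ s' H ((fun u : Set ι => insert e u) ⁻¹' Ga) ((fun u : Set ι => insert e u) ⁻¹' Gb) σ := by
  rw [mem_Pfam, mem_Pfam, cp_insert_update τ he, cp_insert_update τ he, cp_insert_update τ he]
  simp [heτ, hω, faces_update hω]

end MemDecomp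

end

end Summit.CriticalPhenomena.PercolationContinuityZ3.Theorems.ThreePartition
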